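import Summits.AnomalousDissipation.AnomalousDissipation.Theorems.BaireTransferDenseLoudDesignerForcesStubGalileanCovariance

/-!
# Sub-goals `galilean_boost_general` and `galilean_unboost` of the line
# `galilean-detuning-body-force-grid`
# (crux stmt-AnomalousDissipation-1143, `BaireTransfer.DenseLoudDesignerForces`)

The Galilean dictionary between the lab frame and the frame moving with a constant mean momentum
`V` is an EQUIVALENCE of classical Navier–Stokes solutions on `ℝ × T³`:

* `galilean_boost_general` — covariance with an ARBITRARY time-dependent force `g`: if `(w, q)` is a
  classical solution of NS_ν on `ℝ × T³` driven by `g`, then the boost `u t x = V + w t (x - [tV])`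
  (`boost V w`) with the transported pressure `q t (x - [tV])` (`boostScalar V q`) is a classical
  solution of NS_ν driven by the transported force `(t, x) ↦ g t (x - [tV])`. The proof is the landed
  steady-force proof (`Covariance.stub_galileanCovariance`) verbatim: by the chain rule
  `∂ₜu(t,x) = ∂ₜw(t,y) - Dw(t,y)[V]`, `y = x - [tV]`, the space operators of the boost are those of
  `w t` at `y`, and `(u·∇)u (t,x) = (w·∇)w (t,y) + Dw(t,y)[V]`, so the cross terms cancel and the
  momentum equation of `(w, q)` at `(t, y)` with force `g t y` is that of `(u, p)` at `(t, x)`.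
* `galilean_unboost` — the converse transport: a lab-frame classical solution `(u, p)` with a STEADY
  force `F`, read in the moving frame, `w t y = u t (y + [tV]) - V`, `q t y = p t (y + [tV])`, solves
  the SWEPT problem with force `sweptForce V F = F (· + [tV])`. It is `galilean_boost_general` applied
  with the drift `-V`, the force `fun _ => F` and the solution `(u, p)`, after the three pointwise
  identities `boost (-V) u t y = u t (y + [tV]) - V`, `boostScalar (-V) p t y = p t (y + [tV])`,
  `F (y - [t(-V)]) = F (y + [tV])`.

References: Frisch, *Turbulence* (1995) §5.2 (Galilean invariance of Navier–Stokes); the landed module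
`Theorems/BaireTransferDenseLoudDesignerForcesStubGalileanCovariance.lean` (helpers `Covariance.*`).
-/

-- `Summit.<Summit>.<Problem>` is the tree's mandated summit-side namespace (CONVENTIONS §2); for this
-- single-conjunct summit the two coincide, so the duplicate is deliberate.
set_option linter.dupNamespace false

noncomputable section

open scoped BigOperators Topology InnerProductSpace
open Filter Set Function MeasureTheory

-- sub-namespace of the Line vocabulary namespace, so `sweptForce`, `boost`, `goodDrifts`, … resolve unqualified
namespace Summit.AnomalousDissipation.AnomalousDissipation.Theorems.DenseLoudDesignerForces.Galilean.Unboost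

open Literature.Analysis.FunctionSpaces Literature.Analysis.FluidPDE
open Summit.AnomalousDissipation.AnomalousDissipation.Theses.BaireTransfer
open Summit.AnomalousDissipation.AnomalousDissipation.Theorems.DenseLoudDesignerForces.Negative

/-- The flat unit torus `T³`. -/
local notation "𝕋³" => UnitAddTorus (Fin 3)
/-- Real velocity values. -/
local notation "ℝ³" => EuclideanSpace ℝ (Fin 3)
/-- Complex Fourier coefficient values. -/
local notation "ℂ³" => EuclideanSpace ℂ (Fin 3)
/-- The frequency / drift lattice `ℤ³`. -/
local notation "ℤ³" => Fin 3 → ℤ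

/-! ## Covariance with a time-dependent force -/

/-- **Galilean covariance of classical Navier–Stokes solutions on `ℝ × T³` with a TIME-DEPENDENT
force** (registered sub-goal `galilean_boost_general` of the line `galilean-detuning-body-force-grid`):
a classical solution `(w, q)` of NS_ν driven by `g` boosts to the classical solution
`(V + w t (· - [tV]), q t (· - [tV]))` of NS_ν driven by the transported force `g t (· - [tV])`.
[folklore] -/
theorem galilean_boost_general : ∀ (ν : ℝ) (V : ℝ³) (g : ℝ → 𝕋³ → ℝ³) (w : ℝ → 𝕋³ → ℝ³) (q : ℝ → 𝕋³ → ℝ), Torus.IsClassicalNSSolutionOn Set.univ ν g w q → Torus.IsClassicalNSSolutionOn Set.univ ν (fun t x => g t (x - Torus.proj (t • V))) (boost V w) (boostScalar V q) := by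
  intro ν V g w q h
  exact
    { smooth_velocity := Covariance.isSmoothSpaceTimeOn_boost h.smooth_velocity
      smooth_pressure := Covariance.isSmoothSpaceTimeOn_boostScalar h.smooth_pressure
      momentum := fun t _ x => by
        have hm := h.momentum t (mem_univ t) (x - Torus.proj (t • V))
        rw [Covariance.timeDerivWithin_boost h.smooth_velocity, Covariance.convect_boost,
          Covariance.laplacian_boost, Covariance.gradient_boostScalar, sub_add_add_cancel]
        exact hm
      divFree := fun t _ x => by
        rw [Covariance.divergence_boost]
        exact h.divFree t (mem_univ t) _ }

/-! ## The converse transport -/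

/-- Reading a point in the frame moving with `-V`: `y - [t(-V)] = y + [tV]`. [folklore] -/
theorem sub_proj_smul_neg (V : ℝ³) (t : ℝ) (y : 𝕋³) :
    y - Torus.proj (t • (-V)) = y + Torus.proj (t • V) := by
  rw [smul_neg, Torus.proj_neg, sub_neg_eq_add]

/-- The boost by `-V` of a lab-frame velocity is the velocity read in the frame moving with `V`:
`boost (-V) u t y = u t (y + [tV]) - V`. [folklore] -/
theorem boost_neg (V : ℝ³) (u : ℝ → 𝕋³ → ℝ³) :
    boost (-V) u = fun t y => u t (y + Torus.proj (t • V)) - V := by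
  funext t y
  show -V + u t (y - Torus.proj (t • (-V))) = _
  rw [sub_proj_smul_neg, neg_add_eq_sub]

/-- The transport by `-V` of a lab-frame pressure is the pressure read in the frame moving with `V`:
`boostScalar (-V) p t y = p t (y + [tV])`. [folklore] -/
theorem boostScalar_neg (V : ℝ³) (p : ℝ → 𝕋³ → ℝ) :
    boostScalar (-V) p = fun t y => p t (y + Torus.proj (t • V)) := by
  funext t y
  show p t (y - Torus.proj (t • (-V))) = _
  rw [sub_proj_smul_neg]

/-- The transport by `-V` of a steady lab-frame force is the swept force:
`F (y - [t(-V)]) = sweptForce V F t y`. [folklore] -/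
theorem steady_transport_neg (V : ℝ³) (F : 𝕋³ → ℝ³) :
    (fun (t : ℝ) (y : 𝕋³) => (fun _ : ℝ => F) t (y - Torus.proj (t • (-V)))) = sweptForce V F := by
  funext t y
  show F (y - Torus.proj (t • (-V))) = F (y + Torus.proj (t • V))
  rw [sub_proj_smul_neg]

/-- **The converse Galilean transport** (registered sub-goal `galilean_unboost` of the line
`galilean-detuning-body-force-grid`): a lab-frame classical solution `(u, p)` of NS_ν on `ℝ × T³`
with a steady force `F`, read in the frame moving with `V` — `w t y = u t (y + [tV]) - V`,
`q t y = p t (y + [tV])` — is a classical solution of NS_ν driven by the swept force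
`sweptForce V F = F (· + [tV])`; with `galilean_boost_general` / `stub_galileanCovariance` the
drift-class dictionary is an equivalence. Corollary of `galilean_boost_general` with drift `-V`.
[folklore] -/
theorem galilean_unboost : ∀ (ν : ℝ) (V : ℝ³) (F : 𝕋³ → ℝ³) (u : ℝ → 𝕋³ → ℝ³) (p : ℝ → 𝕋³ → ℝ), Torus.IsClassicalNSSolutionOn Set.univ ν (fun _ => F) u p → Torus.IsClassicalNSSolutionOn Set.univ ν (sweptForce V F) (fun t y => u t (y + Torus.proj (t • V)) - V) (fun t y => p t (y + Torus.proj (t • V))) := by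
  intro ν V F u p hu
  have h := galilean_boost_general ν (-V) (fun _ => F) u p hu
  rw [steady_transport_neg, boost_neg, boostScalar_neg] at h
  exact h

end Summit.AnomalousDissipation.AnomalousDissipation.Theorems.DenseLoudDesignerForces.Galilean.Unboost

end
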